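import Summits.QuantumFields.YangMills.Theorems.BalabanUVNodesN21HistoriesModelADefs
import Literature.MathematicalPhysics.QuantumFieldTheory.Balaban1983to89.Node00.RStepRepr218
import Literature.MathematicalPhysics.QuantumFieldTheory.Dimock2011to13.ClusterActivityBound

/-!
# N21 histories road, module 20o — THE ℝ ON∕OFF REGROUPING AT def-R's LETTERS (lens ROW A⁹; Cards 31∕33∕30″ of `LENS-nearmiss.md` v11.0)

Track A of `YM-PLAN.md` (cell `pub-ymgap`, HUMAN RULING D-0062), node **N21** (NE7c `T4IndicatorShell.ShellWeightBound` at explicit carriers); R134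
ACCELERATION SEAT `pub-ymgap-dag-n21-d` (s2), generation 6, module 20o.  PROVENANCE: the planner seat `ym-lens-BalabanUVNodes-nearmiss` g11's farm-checked
`Sketch-nearmiss-g11.lean` (sha16 bca6af737899758f, 427 l.) VERBATIM — declarations, statements and proofs are the lens's; this seat re-homed the namespace,
wrote this header, and inlined the sketch's `Measure.map`-of-a-finset-sum helper (declared by dag-n21-e's module 20n) as a local step.  Ownership: lens v11.0 §4
ROW A⁹ («owner dag-n21-e — else dag-n21-d»; dag-n21-e g8 carries 20m∕20n∕23∕22b∕22c, this seat was free) + cell-bus INTENT-20o.  INDEPENDENT of modules 20m∕20n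
(imports neither): its last theorem produces 20n's `hon` hypothesis as a free-standing inequality.  Imports: module 20f `…N21HistoriesModelADefs` (this seat's
lineage g5; `withDensity_finsetSum'`), node00-def-R FILE 7 `Node00.RStepRepr218` (`Step.Repr218`, `rterm`, `rratio`, `rstepOfSel`, `rstepOfSel_TexpA`), and
`Dimock2011to13.ClusterActivityBound` (`sum_prod_le_prod_one_add_sub_one`, CITED BY NAME).  `[DecidableEq (PBond P j)]` is a section binder exactly as in FILE 7
(TS-8: a consumer holding another instance bridges by `Subsingleton.elim`).  Lane: `--supports` the K3⁗ item `SpineGivenEndpointR13Sep` (stmt-QuantumFields-20292)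
`--as helper`; definition lane (four bookkeeping defs `preim` ∕ `onPre` ∕ `offPre` ∕ `OnOffRatioBound`).

HONEST FRAMING: [folklore] finite-sum ∕ measure bookkeeping (`Finset.filter` ∕ `powerset` ∕ `image`, `withDensity`, `Measure.map`) over def-R FILE 7's letters;
`OnOffRatioBound`, `hdown`, `hcond`, `hoff` are HYPOTHESIS SHAPES — nothing of Bałaban's is asserted; CLFI (lens Card 32, the conditional large-field odds of one
class component) is NOT printed as a lemma and NOT proved here; what print does at [IV] p.176 («localize … polymer expansion … exponentiate») is MORE than the
(M1)-window consumes (only the one-sided conditional ratio bound `hcond`; the far context of a near restoration is regrouped EXACTLY by `sum_on_le_mul_sum_off`).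
NE7c is NOT PRINTED and NOT proved; N21 is NOT discharged; the discharged count of record (5∕27, A-count 5∕28) is UNMOVED by this file; one finite `T⁴_{L,ε}`
at a time — nothing about ℝ⁴, reflection positivity, a mass gap or the Clay problem.  0 `sorry`, standard axioms, COUNT-NEUTRAL.
-/

set_option autoImplicit false

open scoped BigOperators ENNReal
open MeasureTheory
namespace Summit.QuantumFields.YangMills.Theorems.N21HistoriesRStepOnOff

/-! ## §P THE (Eon) REGROUPING over a downward-closed family of restorable component sets -/
section Regroup
variable {κ : Type*} [DecidableEq κ]
/-- `S ↦ S ∖ near` is injective on the sets with a prescribed near part. [folklore] -/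
theorem sdiff_injOn_of_inter_eq (near N : Finset κ) (F : Finset (Finset κ)) :
    Set.InjOn (fun S : Finset κ => S \ near) ↑(F.filter fun S => S ∩ near = N) := by
  intro S₁ h₁ S₂ h₂ h
  have e₁ : S₁ ∩ near = N := (Finset.mem_filter.1 (Finset.mem_coe.1 h₁)).2
  have e₂ : S₂ ∩ near = N := (Finset.mem_filter.1 (Finset.mem_coe.1 h₂)).2
  have h' : S₁ \ near = S₂ \ near := h
  calc S₁ = S₁ \ near ∪ S₁ ∩ near := (Finset.sdiff_union_inter S₁ near).symm
    _ = S₂ \ near ∪ S₂ ∩ near := by rw [h', e₁, e₂]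
    _ = S₂ := Finset.sdiff_union_inter S₂ near

/-- **THE (Eon) REGROUPING.**  `Adm` = the restorable component sets of ONE receiving term (a downward-closed finite family: hard-core compatibility and
the component-local class decision (i)∧(ii) of [IV] p.177 are hereditary), `r S ≥ 0` = the (0.3) ratio of the pre-image restoring `S` (at a fixed field), `near` =
the components whose conditional-integration fibre meets the slot; ONE-SIDED CONDITIONAL RATIO BOUND `r S ≤ ρ (S ∩ near) · r (S ∖ near)` on the sets meeting
`near` ⟹ the ON sum is at most `(Σ_{∅≠N⊆near} ρ N) ×` the OFF sum.  No factorisation of `r`, no cluster expansion, no exponentiation. [folklore] -/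
theorem sum_on_le_mul_sum_off (Adm : Finset (Finset κ)) (near : Finset κ) (r ρ : Finset κ → ℝ)
    (hdown : ∀ S ∈ Adm, ∀ S', S' ⊆ S → S' ∈ Adm)
    (hr : ∀ S ∈ Adm, 0 ≤ r S) (hρ : ∀ N, N ⊆ near → 0 ≤ ρ N)
    (hcond : ∀ S ∈ Adm, (S ∩ near).Nonempty → r S ≤ ρ (S ∩ near) * r (S \ near)) :
    ∑ S ∈ Adm.filter (fun S => (S ∩ near).Nonempty), r S ≤
      (∑ N ∈ near.powerset.filter (fun N => N.Nonempty), ρ N) * ∑ S ∈ Adm.filter (fun S => S ∩ near = ∅), r S := by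
  set ON := Adm.filter (fun S => (S ∩ near).Nonempty) with hON
  set OFF := Adm.filter (fun S => S ∩ near = ∅) with hOFF
  set NN := near.powerset.filter (fun N => N.Nonempty) with hNN
  have hOFF0 : 0 ≤ ∑ S ∈ OFF, r S := Finset.sum_nonneg fun S hS => hr S (Finset.mem_filter.1 hS).1
  -- termwise conditional bound
  have h1 : ∑ S ∈ ON, r S ≤ ∑ S ∈ ON, ρ (S ∩ near) * r (S \ near) :=
    Finset.sum_le_sum fun S hS => hcond S (Finset.mem_filter.1 hS).1 (Finset.mem_filter.1 hS).2
  -- fibrewise by the near part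
  have hmaps : ∀ S ∈ ON, S ∩ near ∈ NN := fun S hS =>
    Finset.mem_filter.2 ⟨Finset.mem_powerset.2 Finset.inter_subset_right, (Finset.mem_filter.1 hS).2⟩
  have h1' : ∑ S ∈ ON, ρ (S ∩ near) * r (S \ near) =
      ∑ N ∈ NN, ∑ S ∈ ON.filter (fun S => S ∩ near = N), ρ (S ∩ near) * r (S \ near) :=
    (Finset.sum_fiberwise_of_maps_to hmaps _).symm
  -- each fibre is at most `ρ N ×` the OFF sum
  have h2 : ∀ N ∈ NN, ∑ S ∈ ON.filter (fun S => S ∩ near = N), ρ (S ∩ near) * r (S \ near) ≤ ρ N * ∑ S ∈ OFF, r S := by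
    intro N hN
    have hNsub : N ⊆ near := Finset.mem_powerset.1 (Finset.mem_filter.1 hN).1
    have himg : (ON.filter (fun S => S ∩ near = N)).image (fun S => S \ near) ⊆ OFF := by
      intro T hT
      obtain ⟨S, hS, rfl⟩ := Finset.mem_image.1 hT
      have hSAdm : S ∈ Adm := (Finset.mem_filter.1 (Finset.mem_filter.1 hS).1).1
      refine Finset.mem_filter.2 ⟨hdown S hSAdm _ Finset.sdiff_subset, ?_⟩
      ext x
      simp only [Finset.mem_inter, Finset.mem_sdiff]
      constructor
      · rintro ⟨⟨-, hx⟩, hx'⟩; exact (hx hx').elim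
      · intro hx; exact absurd hx (by simp)
    calc ∑ S ∈ ON.filter (fun S => S ∩ near = N), ρ (S ∩ near) * r (S \ near)
        = ∑ S ∈ ON.filter (fun S => S ∩ near = N), ρ N * r (S \ near) :=
          Finset.sum_congr rfl fun S hS => by rw [(Finset.mem_filter.1 hS).2]
      _ = ρ N * ∑ S ∈ ON.filter (fun S => S ∩ near = N), r (S \ near) := by rw [Finset.mul_sum]
      _ = ρ N * ∑ T ∈ (ON.filter (fun S => S ∩ near = N)).image (fun S => S \ near), r T := by
          rw [Finset.sum_image (sdiff_injOn_of_inter_eq near N ON)]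
      _ ≤ ρ N * ∑ S ∈ OFF, r S :=
          mul_le_mul_of_nonneg_left
            (Finset.sum_le_sum_of_subset_of_nonneg himg fun S hS _ => hr S (Finset.mem_filter.1 hS).1) (hρ N hNsub)
  calc ∑ S ∈ ON, r S ≤ ∑ N ∈ NN, ∑ S ∈ ON.filter (fun S => S ∩ near = N), ρ (S ∩ near) * r (S \ near) := h1.trans h1'.le
    _ ≤ ∑ N ∈ NN, ρ N * ∑ S ∈ OFF, r S := Finset.sum_le_sum h2
    _ = (∑ N ∈ NN, ρ N) * ∑ S ∈ OFF, r S := by rw [Finset.sum_mul]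
end Regroup

/-! ## §B the binomial count: `Σ_{∅≠N⊆near} Π_{C∈N} ε_C = Π_{C∈near}(1+ε_C) − 1 ≤ (1+ε)^n − 1` -/
section Binomial
variable {κ : Type*} [DecidableEq κ]
/-- `Σ_{∅ ≠ N ⊆ near} Π_{C ∈ N} ε_C = Π_{C ∈ near} (1 + ε_C) − 1`. [folklore] -/
theorem sum_nonempty_powerset_prod_eq (near : Finset κ) (ε : κ → ℝ) :
    ∑ N ∈ near.powerset.filter (fun N => N.Nonempty), ∏ C ∈ N, ε C = ∏ C ∈ near, (1 + ε C) - 1 := by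
  have hsplit := Finset.sum_filter_add_sum_filter_not near.powerset (fun N => N.Nonempty) (fun N => ∏ C ∈ N, ε C)
  have hempty : near.powerset.filter (fun N => ¬ N.Nonempty) = {∅} := by
    ext N
    simp only [Finset.mem_filter, Finset.mem_powerset, Finset.not_nonempty_iff_eq_empty, Finset.mem_singleton]
    constructor
    · rintro ⟨-, h⟩; exact h
    · rintro rfl; exact ⟨Finset.empty_subset _, rfl⟩
  rw [hempty, Finset.sum_singleton, Finset.prod_empty, ← Finset.prod_one_add] at hsplit
  linarith

/-- The inequality half is IN TREE (Dimock's cluster-activity bookkeeping, any family of nonempty `T ⊆ Q`): cited BY NAME. [folklore] -/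
theorem sum_nonempty_powerset_prod_le_inTree (near : Finset κ) (ε : κ → ℝ) (h0 : ∀ C ∈ near, 0 ≤ ε C) :
    ∑ N ∈ near.powerset.filter (fun N => N.Nonempty), ∏ C ∈ N, ε C ≤ ∏ C ∈ near, (1 + ε C) - 1 :=
  Literature.MathematicalPhysics.QuantumFieldTheory.Dimock2011to13.ClusterActivityBound.sum_prod_le_prod_one_add_sub_one h0
    fun _ hN => ⟨Finset.mem_powerset.1 (Finset.mem_filter.1 hN).1, (Finset.mem_filter.1 hN).2⟩

omit [DecidableEq κ] in
/-- … `≤ (1 + ε)^n − 1` when `0 ≤ ε_C ≤ ε` on `near` and `|near| ≤ n` (COUNT: `n ≤ 2^d` by def-R's conventions, Card 30″). [folklore] -/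
theorem prod_one_add_sub_one_le_pow (near : Finset κ) (ε : κ → ℝ) {ε₀ : ℝ} {n : ℕ} (hε₀ : 0 ≤ ε₀)
    (h0 : ∀ C ∈ near, 0 ≤ ε C) (hε : ∀ C ∈ near, ε C ≤ ε₀) (hn : near.card ≤ n) :
    ∏ C ∈ near, (1 + ε C) - 1 ≤ (1 + ε₀) ^ n - 1 := by
  have h1 : ∏ C ∈ near, (1 + ε C) ≤ ∏ _C ∈ near, (1 + ε₀) :=
    Finset.prod_le_prod (fun C hC => by linarith [h0 C hC]) fun C hC => by linarith [hε C hC]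
  rw [Finset.prod_const] at h1
  have h2 : (1 + ε₀) ^ near.card ≤ (1 + ε₀) ^ n := pow_le_pow_right₀ (by linarith) hn
  linarith

/-- The two together: `Σ_{∅≠N⊆near} Π_{C∈N} ε_C ≤ (1+ε)^n − 1`. [folklore] -/
theorem sum_nonempty_powerset_prod_le (near : Finset κ) (ε : κ → ℝ) {ε₀ : ℝ} {n : ℕ} (hε₀ : 0 ≤ ε₀)
    (h0 : ∀ C ∈ near, 0 ≤ ε C) (hε : ∀ C ∈ near, ε C ≤ ε₀) (hn : near.card ≤ n) :
    ∑ N ∈ near.powerset.filter (fun N => N.Nonempty), ∏ C ∈ N, ε C ≤ (1 + ε₀) ^ n - 1 := by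
  rw [sum_nonempty_powerset_prod_eq]
  exact prod_one_add_sub_one_le_pow near ε hε₀ h0 hε hn
end Binomial

/-! ## §K a product structure (conditional independence of separated components under the label-blind kernel) gives `hcond` -/
section ProductStructure
variable {κ : Type*} [DecidableEq κ]
/-- `r S = Π_{C∈S} q_C` with `0 ≤ q_C`, `q_C ≤ ε_C` on `near` ⟹ `r S ≤ (Π_{C ∈ S ∩ near} ε_C) · r (S ∖ near)` — the conditional-ratio bound with
`ρ N = Π_{C∈N} ε_C` (EXACT conditional independence; print has it up to the localisation error of [IV] (1.89)–(1.99), which is why `hcond` and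
not the product structure is the binder of record). [folklore] -/
theorem cond_of_prod (near : Finset κ) (q ε : κ → ℝ) (hq : ∀ C, 0 ≤ q C) (hε : ∀ C ∈ near, q C ≤ ε C) (S : Finset κ) :
    ∏ C ∈ S, q C ≤ (∏ C ∈ S ∩ near, ε C) * ∏ C ∈ S \ near, q C := by
  have hsplit : ∏ C ∈ S, q C = (∏ C ∈ S \ near, q C) * ∏ C ∈ S ∩ near, q C := by
    rw [← Finset.prod_union (Finset.disjoint_sdiff_inter S near), Finset.sdiff_union_inter]
  rw [hsplit, mul_comm]
  refine mul_le_mul_of_nonneg_right ?_ (Finset.prod_nonneg fun C _ => hq C)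
  exact Finset.prod_le_prod (fun C _ => hq C) fun C hC => hε C (Finset.mem_inter.1 hC).2

/-- … hence, for a downward-closed family with product weights, the ON sum is at most `(Π_{C∈near}(1+ε_C) − 1) ×` the OFF sum. [folklore] -/
theorem sum_on_le_of_prod (Adm : Finset (Finset κ)) (near : Finset κ) (q ε : κ → ℝ)
    (hdown : ∀ S ∈ Adm, ∀ S', S' ⊆ S → S' ∈ Adm)
    (hq : ∀ C, 0 ≤ q C) (hε0 : ∀ C ∈ near, 0 ≤ ε C) (hε : ∀ C ∈ near, q C ≤ ε C) :
    ∑ S ∈ Adm.filter (fun S => (S ∩ near).Nonempty), ∏ C ∈ S, q C ≤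
      (∏ C ∈ near, (1 + ε C) - 1) * ∑ S ∈ Adm.filter (fun S => S ∩ near = ∅), ∏ C ∈ S, q C := by
  rw [← sum_nonempty_powerset_prod_eq]
  exact sum_on_le_mul_sum_off Adm near (fun S => ∏ C ∈ S, q C) (fun N => ∏ C ∈ N, ε C) hdown
    (fun S _ => Finset.prod_nonneg fun C _ => hq C)
    (fun N hN => Finset.prod_nonneg fun C hC => hε0 C (hN hC))
    (fun S _ _ => cond_of_prod near q ε hq hε S)
end ProductStructure

/-! ## §D′ the pointwise ratio domination lifts to measures (common density factor `t`) and to every pushforward -/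
section Density
open Summit.QuantumFields.YangMills.Theorems.N21HistoriesModelADefs (withDensity_finsetSum')
variable {Ω : Type*} [MeasurableSpace Ω] {ι : Type*}
/-- **`Σ_ON r_S ≤ δ·Σ_OFF r_S` POINTWISE ⟹ `Σ_ON γ.withDensity (t·r_S) ≤ δ • Σ_OFF γ.withDensity (t·r_S)`** — the (0.3) summands of one receiving term share the
factor `t = t_{a'}`; `γ` = the reference measure of the current field's space. [folklore] -/
theorem sum_withDensity_le_smul_sum (γ : Measure Ω) (ON OFF : Finset ι) {t : Ω → ℝ≥0∞} {r : ι → Ω → ℝ≥0∞}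
    (ht : Measurable t) (hr : ∀ s, Measurable (r s)) {δ : ℝ≥0∞}
    (hδ : ∀ x, ∑ s ∈ ON, r s x ≤ δ * ∑ s ∈ OFF, r s x) :
    ∑ s ∈ ON, γ.withDensity (fun x => t x * r s x) ≤ δ • ∑ s ∈ OFF, γ.withDensity (fun x => t x * r s x) := by
  have hm : ∀ s, Measurable (fun x => t x * r s x) := fun s => ht.mul (hr s)
  rw [← withDensity_finsetSum' ON γ (fun s x => t x * r s x) hm, ← withDensity_finsetSum' OFF γ (fun s x => t x * r s x) hm,
    ← withDensity_smul δ (Finset.measurable_sum OFF fun s _ => hm s)]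
  refine withDensity_mono (Filter.Eventually.of_forall fun x => ?_)
  simp only [Pi.smul_apply, smul_eq_mul]
  rw [← Finset.mul_sum, ← Finset.mul_sum, mul_left_comm]
  exact mul_le_mul' le_rfl (hδ x)

/-- … and for the marginal of every statistic. [folklore] -/
theorem sum_map_withDensity_le_smul_sum (γ : Measure Ω) (ON OFF : Finset ι) {t : Ω → ℝ≥0∞} {r : ι → Ω → ℝ≥0∞}
    (ht : Measurable t) (hr : ∀ s, Measurable (r s)) {δ : ℝ≥0∞}
    (hδ : ∀ x, ∑ s ∈ ON, r s x ≤ δ * ∑ s ∈ OFF, r s x) {u : Ω → ℝ} (hu : Measurable u) :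
    ∑ s ∈ ON, (γ.withDensity fun x => t x * r s x).map u ≤ δ • ∑ s ∈ OFF, (γ.withDensity fun x => t x * r s x).map u := by
  -- `Measure.map u` of a finite sum of measures (the lens's `measureMap_finsetSum`; declared in the tree by module 20n, inlined here)
  have hms : ∀ (F : Finset ι) (μ : ι → Measure Ω), (∑ i ∈ F, μ i).map u = ∑ i ∈ F, (μ i).map u := by
    intro F μ
    classical
    refine Finset.induction_on F ?_ ?_
    · simp
    · intro i F hi ih
      rw [Finset.sum_insert hi, Finset.sum_insert hi, Measure.map_add _ _ hu, ih]
  rw [← hms ON, ← hms OFF, ← Measure.map_smul]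
  exact Measure.map_mono (sum_withDensity_le_smul_sum γ ON OFF ht hr hδ) hu

/-- **module 20n's `hon` may be fed POST-ℝ on the OFF side**: a domination of the ON laws of each `sel`-fibre by `δ ×` the POST-ℝ OFF laws of the same fibre,
plus the resampling lift's (Eoff) (`hoff`: OFF terms keep the `u`-marginal), IS `hon` (whose OFF side is pre-ℝ). [folklore] -/
theorem hon_of_postOff [DecidableEq ι] (I : Finset ι) (J Jpre : ι → Measure Ω) (sel : ι → ι) (On : Finset ι) {u : Ω → ℝ}
    {δ : ℝ≥0∞}
    (hoff : ∀ s ∈ I, s ∉ On → (J s).map u = (Jpre s).map u)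
    (hdom : ∀ s' ∈ I, ∑ s ∈ I.filter (fun s => s ∈ On ∧ sel s = s'), (J s).map u ≤
      δ • ∑ s ∈ I.filter (fun s => s ∉ On ∧ sel s = s'), (J s).map u) :
    ∀ s' ∈ I, ∑ s ∈ I.filter (fun s => s ∈ On ∧ sel s = s'), (J s).map u ≤
      δ • ∑ s ∈ I.filter (fun s => s ∉ On ∧ sel s = s'), (Jpre s).map u := by
  intro s' hs'
  refine (hdom s' hs').trans (le_of_eq ?_)
  rw [Finset.sum_congr rfl fun s hs => hoff s (Finset.mem_filter.1 hs).1 (Finset.mem_filter.1 hs).2.1]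
end Density

/-! ## §R AT def-R's LETTERS: the ON∕OFF split of (0.3)'s pre-image sum and the producer-side binder `OnOffRatioBound` -/
section DefR
open Literature.MathematicalPhysics.QuantumFieldTheory.Balaban1983to89
open Literature.MathematicalPhysics.QuantumFieldTheory.Balaban1983to89.Node00 (rterm rratio rstepOfSel rstepOfSel_TexpA)
variable {P : Params} {G : Type*} [GaugeGroup G] [MeasurableSpace G] [HaarData G] {j : ℕ} [DecidableEq (PBond P j)]
open Classical in
/-- the pre-images of the receiving sequence `a'` under print's selector (the index set of (0.3)'s inner sum at `a'`). [folklore] -/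
noncomputable def preim (r : Step.Repr218 P G j) (sel : r.Adm → r.Adm) (a' : r.Adm) : Finset r.Adm :=
  Finset.univ.filter fun a => sel a = a'

/-- **ON pre-images** for the slot's bond set `B`: those whose `Z′`-fibre MEETS `B` (def-R FILE 5: `fib = fibOfSeq` = the bonds meeting `Z′(a)`). [folklore] -/
noncomputable def onPre (r : Step.Repr218 P G j) (sel : r.Adm → r.Adm) (fib : r.Adm → Finset (PBond P j)) (B : Finset (PBond P j))
    (a' : r.Adm) : Finset r.Adm :=
  (preim r sel a').filter fun a => ¬ Disjoint (fib a) B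

/-- **OFF pre-images**: those whose `Z′`-fibre misses `B` (the receiving term itself, when ℝ-fixed with empty fibre, is one of them). [folklore] -/
noncomputable def offPre (r : Step.Repr218 P G j) (sel : r.Adm → r.Adm) (fib : r.Adm → Finset (PBond P j)) (B : Finset (PBond P j))
    (a' : r.Adm) : Finset r.Adm :=
  (preim r sel a').filter fun a => Disjoint (fib a) B

omit [MeasurableSpace G] [HaarData G] in
/-- (0.3)'s inner sum at `a'` splits ON + OFF. [folklore] -/
theorem sum_preim_eq_on_add_off (r : Step.Repr218 P G j) (sel : r.Adm → r.Adm) (fib : r.Adm → Finset (PBond P j))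
    (B : Finset (PBond P j)) (a' : r.Adm) (f : r.Adm → ℝ) :
    ∑ a ∈ preim r sel a', f a = ∑ a ∈ onPre r sel fib B a', f a + ∑ a ∈ offPre r sel fib B a', f a := by
  rw [onPre, offPre, add_comm]
  exact (Finset.sum_filter_add_sum_filter_not _ (fun a => Disjoint (fib a) B) f).symm

open Classical in
/-- … so the R-stepped representation's new slot reads `(𝐓e^A)'(a') = (𝐓e^A)(a') · (Σ_ON + Σ_OFF)` (def-R's `rstepOfSel_TexpA`). [folklore] -/
theorem rstepOfSel_TexpA_on_add_off (r : Step.Repr218 P G j) (sel : r.Adm → r.Adm) (fib : r.Adm → Finset (PBond P j))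
    (B : Finset (PBond P j)) (a' : r.Adm) (V : GaugeField P j G) :
    (rstepOfSel r sel fib).TexpA a' V =
      r.TexpA a' V * (∑ a ∈ onPre r sel fib B a', rratio r fib a a' V + ∑ a ∈ offPre r sel fib B a', rratio r fib a a' V) := by
  rw [rstepOfSel_TexpA, ← sum_preim_eq_on_add_off]
  rfl

/-- **THE PRODUCER-SIDE BINDER AT def-R's LETTERS (Card 33)**: for the slot's bond set `B` and a constant `δ`, at every receiving sequence and every field
the (0.3) ratios of the ON pre-images are dominated by `δ ×` those of the OFF pre-images.  (`δ = δ_loc`; by §P it follows from the conditional-ratio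
bound on a component reading of the pre-images, `onOffRatioBound_of_components`.)  A HYPOTHESIS SHAPE — nothing asserted. [folklore] -/
def OnOffRatioBound (r : Step.Repr218 P G j) (sel : r.Adm → r.Adm) (fib : r.Adm → Finset (PBond P j)) (B : Finset (PBond P j))
    (δ : ℝ) : Prop :=
  ∀ a' V, ∑ a ∈ onPre r sel fib B a', rratio r fib a a' V ≤ δ * ∑ a ∈ offPre r sel fib B a', rratio r fib a a' V

/-- Under the binder, the ON part of the post-ℝ density at `a'` is at most `δ ×` its OFF part, pointwise (the common factor `t_{a'} ≥ 0`). [folklore] -/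
theorem rterm_mul_on_le {r : Step.Repr218 P G j} {sel : r.Adm → r.Adm} {fib : r.Adm → Finset (PBond P j)} {B : Finset (PBond P j)}
    {δ : ℝ} (h : OnOffRatioBound r sel fib B δ) (a' : r.Adm) (V : GaugeField P j G) (ht : 0 ≤ rterm r a' V) :
    rterm r a' V * ∑ a ∈ onPre r sel fib B a', rratio r fib a a' V ≤
      δ * (rterm r a' V * ∑ a ∈ offPre r sel fib B a', rratio r fib a a' V) := by
  rw [mul_left_comm]
  exact mul_le_mul_of_nonneg_left (h a' V) ht

/-- **§P AT def-R's LETTERS.**  Given NODE O's COMPONENT READING of the pre-images of `a'` — `cmp a` = the set of restored components, injective on the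
pre-images, with downward-closed image, the fibre of `a` the union of its components' fibres — and, at the field `V`, the ratios as a function of the
component set obeying the one-sided conditional bound, the ON∕OFF ratio domination holds at `(a', V)` with `δ = Σ_{∅≠N⊆near} ρ N`, `near` = the
components whose fibre meets `B`. [folklore] -/
theorem onOff_le_of_components {κ : Type*} [DecidableEq κ] (r : Step.Repr218 P G j) (sel : r.Adm → r.Adm)
    (fib : r.Adm → Finset (PBond P j)) (B : Finset (PBond P j)) (a' : r.Adm) (V : GaugeField P j G)
    (cmp : r.Adm → Finset κ) (fibC : κ → Finset (PBond P j)) (near : Finset κ) (R ρ : Finset κ → ℝ)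
    (hinj : Set.InjOn cmp ↑(preim r sel a'))
    (hdown : ∀ a ∈ preim r sel a', ∀ S', S' ⊆ cmp a → ∃ b ∈ preim r sel a', cmp b = S')
    (hfib : ∀ a ∈ preim r sel a', fib a = (cmp a).biUnion fibC)
    (hnear : ∀ a ∈ preim r sel a', ∀ C ∈ cmp a, (C ∈ near ↔ ¬ Disjoint (fibC C) B))
    (hR : ∀ a ∈ preim r sel a', rratio r fib a a' V = R (cmp a))
    (hR0 : ∀ a ∈ preim r sel a', 0 ≤ R (cmp a)) (hρ : ∀ N, N ⊆ near → 0 ≤ ρ N)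
    (hcond : ∀ a ∈ preim r sel a', (cmp a ∩ near).Nonempty → R (cmp a) ≤ ρ (cmp a ∩ near) * R (cmp a \ near)) :
    ∑ a ∈ onPre r sel fib B a', rratio r fib a a' V ≤
      (∑ N ∈ near.powerset.filter (fun N => N.Nonempty), ρ N) * ∑ a ∈ offPre r sel fib B a', rratio r fib a a' V := by
  classical
  set Adm := (preim r sel a').image cmp with hAdm
  -- ON ∕ OFF read on the component sets
  have hon_iff : ∀ a ∈ preim r sel a', (¬ Disjoint (fib a) B ↔ (cmp a ∩ near).Nonempty) := by
    intro a ha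
    rw [hfib a ha, Finset.disjoint_biUnion_left]
    push Not
    constructor
    · rintro ⟨C, hC, hCB⟩
      exact ⟨C, Finset.mem_inter.2 ⟨hC, (hnear a ha C hC).2 hCB⟩⟩
    · rintro ⟨C, hC⟩
      exact ⟨C, (Finset.mem_inter.1 hC).1, (hnear a ha C (Finset.mem_inter.1 hC).1).1 (Finset.mem_inter.1 hC).2⟩
  have hoff_iff : ∀ a ∈ preim r sel a', (Disjoint (fib a) B ↔ cmp a ∩ near = ∅) := by
    intro a ha
    rw [← not_iff_not, hon_iff a ha, Finset.nonempty_iff_ne_empty]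
  -- transport both sums to `Adm`
  have hinjOn : Set.InjOn cmp ↑(onPre r sel fib B a') := hinj.mono (by
    intro a ha; exact Finset.mem_coe.2 (Finset.mem_filter.1 (Finset.mem_coe.1 ha)).1)
  have hinjOff : Set.InjOn cmp ↑(offPre r sel fib B a') := hinj.mono (by
    intro a ha; exact Finset.mem_coe.2 (Finset.mem_filter.1 (Finset.mem_coe.1 ha)).1)
  have hONimg : (onPre r sel fib B a').image cmp = Adm.filter (fun S => (S ∩ near).Nonempty) := by
    ext S
    simp only [Finset.mem_image, Finset.mem_filter, onPre, hAdm]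
    constructor
    · rintro ⟨a, ⟨ha, hnd⟩, rfl⟩
      exact ⟨⟨a, ha, rfl⟩, (hon_iff a ha).1 hnd⟩
    · rintro ⟨⟨a, ha, rfl⟩, hne⟩
      exact ⟨a, ⟨ha, (hon_iff a ha).2 hne⟩, rfl⟩
  have hOFFimg : (offPre r sel fib B a').image cmp = Adm.filter (fun S => S ∩ near = ∅) := by
    ext S
    simp only [Finset.mem_image, Finset.mem_filter, offPre, hAdm]
    constructor
    · rintro ⟨a, ⟨ha, hd⟩, rfl⟩
      exact ⟨⟨a, ha, rfl⟩, (hoff_iff a ha).1 hd⟩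
    · rintro ⟨⟨a, ha, rfl⟩, he⟩
      exact ⟨a, ⟨ha, (hoff_iff a ha).2 he⟩, rfl⟩
  have hsumON : ∑ a ∈ onPre r sel fib B a', rratio r fib a a' V = ∑ S ∈ Adm.filter (fun S => (S ∩ near).Nonempty), R S := by
    rw [← hONimg, Finset.sum_image hinjOn]
    exact Finset.sum_congr rfl fun a ha => hR a (Finset.mem_filter.1 ha).1
  have hsumOFF : ∑ a ∈ offPre r sel fib B a', rratio r fib a a' V = ∑ S ∈ Adm.filter (fun S => S ∩ near = ∅), R S := by
    rw [← hOFFimg, Finset.sum_image hinjOff]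
    exact Finset.sum_congr rfl fun a ha => hR a (Finset.mem_filter.1 ha).1
  rw [hsumON, hsumOFF]
  -- the hypotheses of §P on `Adm`
  have hdown' : ∀ S ∈ Adm, ∀ S', S' ⊆ S → S' ∈ Adm := by
    intro S hS S' hS'
    obtain ⟨a, ha, rfl⟩ := Finset.mem_image.1 hS
    obtain ⟨b, hb, hbS⟩ := hdown a ha S' hS'
    exact Finset.mem_image.2 ⟨b, hb, hbS⟩
  have hr' : ∀ S ∈ Adm, 0 ≤ R S := by
    intro S hS
    obtain ⟨a, ha, rfl⟩ := Finset.mem_image.1 hS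
    exact hR0 a ha
  have hcond' : ∀ S ∈ Adm, (S ∩ near).Nonempty → R S ≤ ρ (S ∩ near) * R (S \ near) := by
    intro S hS hne
    obtain ⟨a, ha, rfl⟩ := Finset.mem_image.1 hS
    exact hcond a ha hne
  exact sum_on_le_mul_sum_off Adm near R ρ hdown' hr' hρ hcond'

/-- The binder in §D′'s currency: `Σ_ON ofReal(ratio) ≤ ofReal δ · Σ_OFF ofReal(ratio)` at every `(a', V)` — every (0.3) ratio is `≥ 0` (a quotient of two
`toReal`s; NODE O K0a's `Record12LiveSelector.rratio_nonneg` is the `SU(N)` instance). [folklore] -/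
theorem ofReal_on_le_of_onOffRatioBound {r : Step.Repr218 P G j} {sel : r.Adm → r.Adm} {fib : r.Adm → Finset (PBond P j)}
    {B : Finset (PBond P j)} {δ : ℝ} (h : OnOffRatioBound r sel fib B δ) (hδ : 0 ≤ δ) (a' : r.Adm) (V : GaugeField P j G) :
    ∑ a ∈ onPre r sel fib B a', ENNReal.ofReal (rratio r fib a a' V) ≤
      ENNReal.ofReal δ * ∑ a ∈ offPre r sel fib B a', ENNReal.ofReal (rratio r fib a a' V) := by
  have h0 : ∀ a, 0 ≤ rratio r fib a a' V := fun a => by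
    unfold rratio B15.BasicStep.fibreIntegral
    exact div_nonneg ENNReal.toReal_nonneg ENNReal.toReal_nonneg
  rw [← ENNReal.ofReal_sum_of_nonneg (fun a _ => h0 a), ← ENNReal.ofReal_sum_of_nonneg (fun a _ => h0 a), ← ENNReal.ofReal_mul hδ]
  exact ENNReal.ofReal_le_ofReal (h a' V)

open Classical in
/-- **END-TO-END AT def-R's LETTERS ⟹ module 20n's `hon` (Card 31 ⟹ Card 29's (Eon)).**  On a histories space `Ω` with reference measure `γ` and current-field map
`Vk`, let the post-ℝ term law of the pre-image `a` be `J a = (t_{sel a} · ratio_{a, sel a}) ∘ Vk · γ` ((0.3), def-R `rstepOfSel_TexpA`), `On` = the pre-images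
whose `Z′`-fibre meets the slot's bond set `B`, and let the OFF terms keep the `u`-marginal of their pre-ℝ laws `Jpre` ((Eoff), the resampling identity —
HYPOTHESIS `hoff`).  Then `OnOffRatioBound r sel fib B δ` delivers `hon` of module 20n's `sum_map_le_of_offOn` VERBATIM (index set `univ`, constant `ofReal δ`). [folklore] -/
theorem hon_of_onOffRatioBound {Ω : Type*} [MeasurableSpace Ω] (γ : Measure Ω) (Vk : Ω → GaugeField P j G)
    {r : Step.Repr218 P G j} {sel : r.Adm → r.Adm} {fib : r.Adm → Finset (PBond P j)} {B : Finset (PBond P j)} {δ : ℝ}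
    (h : OnOffRatioBound r sel fib B δ) (hδ : 0 ≤ δ)
    (hmt : ∀ a', Measurable fun x => ENNReal.ofReal (rterm r a' (Vk x)))
    (hmr : ∀ a a', Measurable fun x => ENNReal.ofReal (rratio r fib a a' (Vk x)))
    (J Jpre : r.Adm → Measure Ω)
    (hJ : ∀ a, J a = γ.withDensity fun x => ENNReal.ofReal (rterm r (sel a) (Vk x)) * ENNReal.ofReal (rratio r fib a (sel a) (Vk x)))
    (On : Finset r.Adm) (hOn : ∀ a, a ∈ On ↔ ¬ Disjoint (fib a) B)
    {u : Ω → ℝ} (hu : Measurable u) (hoff : ∀ a ∈ (Finset.univ : Finset r.Adm), a ∉ On → (J a).map u = (Jpre a).map u) :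
    ∀ a' ∈ (Finset.univ : Finset r.Adm),
      ∑ a ∈ Finset.univ.filter (fun a => a ∈ On ∧ sel a = a'), (J a).map u ≤
        ENNReal.ofReal δ • ∑ a ∈ Finset.univ.filter (fun a => a ∉ On ∧ sel a = a'), (Jpre a).map u := by
  refine hon_of_postOff Finset.univ J Jpre sel On hoff fun a' _ => ?_
  have hONeq : Finset.univ.filter (fun a => a ∈ On ∧ sel a = a') = onPre r sel fib B a' := by
    ext a
    simp only [Finset.mem_filter, Finset.mem_univ, true_and, onPre, preim, hOn]
    exact and_comm
  have hOFFeq : Finset.univ.filter (fun a => a ∉ On ∧ sel a = a') = offPre r sel fib B a' := by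
    ext a
    simp only [Finset.mem_filter, Finset.mem_univ, true_and, offPre, preim, hOn, not_not]
    exact and_comm
  rw [hONeq, hOFFeq]
  have hJ' : ∀ a ∈ preim r sel a',
      J a = γ.withDensity fun x => ENNReal.ofReal (rterm r a' (Vk x)) * ENNReal.ofReal (rratio r fib a a' (Vk x)) := by
    intro a ha
    have hsa : sel a = a' := by simpa [preim] using ha
    rw [hJ a, hsa]
  have hsON : ∑ a ∈ onPre r sel fib B a', (J a).map u =
      ∑ a ∈ onPre r sel fib B a', (γ.withDensity fun x => ENNReal.ofReal (rterm r a' (Vk x)) * ENNReal.ofReal (rratio r fib a a' (Vk x))).map u :=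
    Finset.sum_congr rfl fun a ha => by rw [hJ' a (Finset.mem_filter.1 ha).1]
  have hsOFF : ∑ a ∈ offPre r sel fib B a', (J a).map u =
      ∑ a ∈ offPre r sel fib B a', (γ.withDensity fun x => ENNReal.ofReal (rterm r a' (Vk x)) * ENNReal.ofReal (rratio r fib a a' (Vk x))).map u :=
    Finset.sum_congr rfl fun a ha => by rw [hJ' a (Finset.mem_filter.1 ha).1]
  rw [hsON, hsOFF]
  exact sum_map_withDensity_le_smul_sum γ _ _ (hmt a') (fun a => hmr a a')
    (fun x => ofReal_on_le_of_onOffRatioBound h hδ a' (Vk x)) hu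
end DefR
end Summit.QuantumFields.YangMills.Theorems.N21HistoriesRStepOnOff
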